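import Summits.BirchSwinnertonDyer.BirchSwinnertonDyer.Theorems.CMKolyvaginAtInertTwoCMKolyvaginConjectureAtInertTwoObstructionClassEpsilonLine
import Summits.BirchSwinnertonDyer.BirchSwinnertonDyer.Theorems.CMKolyvaginAtInertTwoStrictDescentOfSelmerMinusAtTwo
import Summits.BirchSwinnertonDyer.BirchSwinnertonDyer.Theorems.CMKolyvaginAtInertTwoConjugationTypeAtTwo
import Summits.BirchSwinnertonDyer.BirchSwinnertonDyer.Theorems.CMKolyvaginAtInertTwoTranspositionAtTwo
import Summits.BirchSwinnertonDyer.Uniform.U2.RingClassNoTwoTorsion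
import Summits.BirchSwinnertonDyer.Rank1Residual.X11b.Three.KolyvaginLine
import Literature.NumberTheory.EllipticCurves.BSDSelmerPConverseYanZhuKolyvaginSystemProofs
import Literature.NumberTheory.EllipticCurves.HeegnerPointsOfConductorOneGaloisConjProofs
import Literature.NumberTheory.EllipticCurves.BSDHeegnerPointsGrossZagierProofs
import Literature.NumberTheory.EllipticCurves.TwoAdicImageSurjectivityModTwoProofs
import Literature.NumberTheory.EllipticCurves.HeegnerPointsIdentityComponentProofs
import Literature.NumberTheory.QuadraticFields.QuadraticDedekindZeta
import HarnessLib

/-!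
# Route `CMKolyvaginAtInertTwo`, crux `CMKolyvaginConjectureAtInertTwo` (stmt-BirchSwinnertonDyer-24648),
# stub `stub_positiveDepth` — census item L4: the `ε`-LINE, `rank E(K) = 1` and the `K`-RATIONAL HEEGNER
# POINT UNDER `P(1)`, DISCHARGED ON THE CRUX'S OWN FRAME from ONE named fact (Kolyvagin's theorem)

Seat `leafhand-bsd-cmkolyvaginatinert-8` g0 (cell `bsd-eis`); helper `--supports stmt-BirchSwinnertonDyer-24648`.
THEOREMS ONLY: no definition, no named fact introduced, no `sorry`; no stub, crux or summit closed; BSD proved for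
no curve.  Hands 5–7's first-descent theorems at `2` carry, besides the route's standing machine inputs, FRAME inputs
that are NOT binders of `stub_positiveDepth`: a conjugation `τ ≠ 1`; the `ε`-line `hline : ∀ x ∈ E(K), τ x − (−w(E)) x
torsion`; `rank E(K) = 1`; a `K`-rational Heegner point `Ph` of infinite order — resp. (hand 7) `P ∈ E(K)` Heegner with
`2^{M₀} ∥ P` IN `E(K)` and `cP − νP` non-torsion.  Hand 6's census (L4) asked to discharge them on H₂ and recorded the
bridge `KolyvaginHeegnerData … 1 ↦ IsHeegnerPoint … K Ph` as «not located in tree».  It IS in the tree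
(`heegnerSystem_exists_isHeegnerPoint_map_eq_derivedPoint_one`, its Shimura-reciprocity input PROVED as
`heegnerPointOfConductor_one_galoisConj_holds`), and this file does the discharge:
* §1 `τ ≠ 1` exists; `exists_isHeegnerPoint_map_eq_derivedPoint_one_of_not_isOfFinAddOrder` — under the stub's binders
  there is `Ph ∈ E(K)`, a Heegner point of level `N_E` of INFINITE ORDER mapping to `P(1)` in `E(K[1])`.
* §2 `rank E(K) = 1 ∧ Ш(E/K)` finite on the stub's frame from the ONE named fact `kolyvagin N_E W K` (Kolyvagin 1990
  Thm. A / Gross 1991 Thm. 1.3); variant from `gross_zagier N_E W K` + bsd.S16 `mordellWeilRank_eq_one_of_LDerivEK_ne_zero`.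
* §3 `isOfFinAddOrder_map_sub_smul_of_derivedPoint_one_of_kolyvagin` — **the `ε`-line on the stub's frame** modulo
  `kolyvagin` only (hand 6's `isOfFinAddOrder_map_sub_smul_of_mordellWeilRank_eq_one` ∘ §1 ∘ §2).
* §4 hand 6's trivial-`Ш` theorems RE-ISSUED IN STUB CURRENCY (binders of `stub_positiveDepth` verbatim + Gross 3.7 (2)
  `prop37_2_reductionCongruence_inert` + `kolyvagin`): if `Ш(E/K)[2^∞] = ⊥` the exact depth `M₀ ≥ 1` exists and every
  Zhang–Kolyvagin prime `ℓ` at `2` of index `≥ M₀` and every datum `e` keep `2^{M₀−1} ∣ P_e(ℓ)`; with `4 ∣ P(1)`,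
  `M₀ ≥ 2` and every such `P_e(ℓ) ∈ 2E(K[ℓ])` — in the trivial-`Ш` regime of depth `≥ 2` a crux witness `(n, d)` is
  never a single deep prime.
* §5 `exists_heegnerPoint_exactDepth_of_derivedPoint_one` — hand 7's `E(K)`-currency frame from the stub's binders, NO
  named fact: `2^{M₀} ∥ P(1)` in `E(K[1])` iff `2^{M₀} ∥ Ph` in `E(K)` (`E(K[1])[2^∞] = 0` on the habitat; McCallum
  Lemma 5.1 = `Koly.pDiv_one_iff_exists_zsmul_eq`), and `c Ph − w(E) Ph` is NOT torsion (Gross Prop. 5.3, tree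
  `X11b.KolyvaginBottom.isOfFinAddOrder_map_sub_neg_rootNumber_smul`) — i.e. `(hHP, hM₀, hM₀', hν, hPν)` with `ν = w(E)`.
* §6 `exists_strictDescent_of_selmer_minus_two_zsmul_ne_zero_of_derivedPoint_one` — hand 7's «one strict step from
  an element of order `≥ 4` in `Sel^{w(E)}`» ON THE STUB'S FRAME: `(hHP, hM₀, hM₀', hν, hPν, hΔ, hΔK)` discharged by §5
  and the route's `Δ_neg_of_cmInert_two` / `not_isSquare_algebraMap_Δ_of_cmInert_two_of_heegner`; what remains visible
  is EXACTLY the route's standing machine input at `2` (`h372`, binder `h53`, Cartan-type `z`/`hzfix`/`hcomm`, ty2's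
  reciprocity DATA `R`) and the Selmer-side trigger; the prime is returned in the crux's currency (W. Zhang's).
HONEST FRAMING.  Plumbing between landed theorems; non-kernel inputs = the NAMED FACTS `kolyvagin` (resp.
`gross_zagier` + S16) and, in §4, `prop37_2_reductionCongruence_inert` — published theorems, no `_holds` in the tree.
Nothing here touches the research core of `stub_positiveDepth` (census L2).  References: [cite: GrossLMS1991, §1
Thm. 1.3, §4, §5 Prop. 5.3] [cite: Kolyvagin1990, Thm. A] [cite: McCallumLMS1991, §5 Lemma 5.1, Thm. 5.4] [cite: Darmon2004, Thm. 3.7]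
presearch: tree hits `heegnerSystem_exists_isHeegnerPoint_map_eq_derivedPoint_one`, `kolyvagin`, `lDerivEK_ne_zero_iff_…`,
`isOfFinAddOrder_map_sub_neg_rootNumber_smul` (reused by name); print = Gross 1991 [corpus: book:editornd-l-functions-arithmetic].
-/

set_option autoImplicit false
set_option linter.dupNamespace false -- the Theorems namespace repeats the summit name by design (D-0017)

noncomputable section
open scoped Classical
open Field NumberField IsDedekindDomain Function WeierstrassCurve
open Literature.NumberTheory.EllipticCurves
open Literature.NumberTheory.EllipticCurves.ModularForms
open Literature.NumberTheory.GaloisRepresentations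
open Literature.NumberTheory.GaloisCohomology
open Literature.NumberTheory.EllipticCurves.GrossLMS1991 (prop37_2_reductionCongruence_inert)
open Summit.BirchSwinnertonDyer.Rank1Residual.X11b.Three (Koly.PDiv Koly.pDiv_one_iff_exists_zsmul_eq)

namespace Summit.BirchSwinnertonDyer.BirchSwinnertonDyer.Theorems.CMKolyvaginFirstDescentTwo

variable (W : WeierstrassCurve ℚ) [W.IsElliptic] [W.IsGloballyMinimal] [NeZero (W.conductorNorm ℤ)]
  {K : Type} [Field K] [NumberField K]

/-! ## §1 A complex conjugation, and the `K`-rational Heegner point under `P(1)` -/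

/-- An imaginary quadratic field has a non-trivial `ℚ`-automorphism (it is Galois of degree `2`). [folklore] -/
theorem exists_algEquiv_ne_one_of_isImaginaryQuadratic (hK : IsImaginaryQuadratic K) :
    ∃ τ : K ≃ₐ[ℚ] K, τ ≠ 1 := by
  haveI : Algebra.IsQuadraticExtension ℚ K := ⟨hK.1⟩
  have hcard : Nat.card (K ≃ₐ[ℚ] K) = 2 := by rw [IsGalois.card_aut_eq_finrank, hK.1]
  haveI : Nontrivial (K ≃ₐ[ℚ] K) := Finite.one_lt_card_iff_nontrivial.mp (by omega)
  exact exists_ne 1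

omit [W.IsGloballyMinimal] in
/-- **`P(1) = Tr_{K[1]/K} y(1)` descends to a `K`-rational Heegner point of infinite order.**  For `K` imaginary
quadratic with the Heegner hypothesis for `N_E` and a conductor-`1` Kolyvagin–Heegner datum `d₁` on `(Dt, β, ι)` whose
derived point `P(1)` has infinite order, there is `Ph ∈ E(K)` which is a Heegner point of level `N_E`
(`IsHeegnerPoint`), maps to `P(1)` under `E(K) → E(K[1])`, and has infinite order.  Bridge = the tree's
`heegnerSystem_exists_isHeegnerPoint_map_eq_derivedPoint_one` ∘ `heegnerPointOfConductor_one_galoisConj_holds`.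
[cite: GrossLMS1991, §4 (P_1 = Tr y_1 = y_K)] [cite: Darmon2004, Thm. 3.7] -/
theorem exists_isHeegnerPoint_map_eq_derivedPoint_one_of_not_isOfFinAddOrder (hK : IsImaginaryQuadratic K)
    (hHe : SatisfiesHeegnerHypothesis (W.conductorNorm ℤ) K)
    (Dt : ModularParametrizationData W (W.conductorNorm ℤ)) (β : ℤ) (ι : K →+* ℂ)
    (d₁ : KolyvaginHeegnerData Dt β ι 1) (hy : ¬ IsOfFinAddOrder d₁.derivedPoint) :
    ∃ Ph : (W.baseChange K).toAffine.Point, IsHeegnerPoint (W.conductorNorm ℤ) W K Ph ∧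
      Affine.Point.map (W' := W) (algebraMap K (ringClassField K ι 1)).toRatAlgHom Ph = d₁.derivedPoint ∧
      ¬ IsOfFinAddOrder Ph := by
  obtain ⟨Ph, hPh, hmap⟩ := heegnerSystem_exists_isHeegnerPoint_map_eq_derivedPoint_one
    (heegnerPointOfConductor_one_galoisConj_holds (W.conductorNorm ℤ) W K) hK hHe d₁
  refine ⟨Ph, hPh, hmap, fun hfin ↦ hy ?_⟩
  rw [← hmap]
  exact AddMonoidHom.isOfFinAddOrder _ hfin

/-! ## §2 `rank E(K) = 1` on the stub's frame, from Kolyvagin's theorem (resp. Gross–Zagier + bsd.S16) -/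

omit [W.IsGloballyMinimal] in
/-- **`rank E(K) = 1` and `Ш(E/K)` finite on the stub's frame, modulo Kolyvagin's theorem** (the named fact
`kolyvagin N_E W K`: «`y_K` of infinite order ⟹ `rank E(K) = 1`, `Ш(E/K)` finite») at the Heegner point of §1.
[cite: Kolyvagin1990, Thm. A] [cite: GrossLMS1991, §1 Thm. 1.3] -/
theorem mordellWeilRank_eq_one_of_derivedPoint_one_of_kolyvagin
    (hKoly : kolyvagin (W.conductorNorm ℤ) W K) (hK : IsImaginaryQuadratic K)
    (hHe : SatisfiesHeegnerHypothesis (W.conductorNorm ℤ) K)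
    (Dt : ModularParametrizationData W (W.conductorNorm ℤ)) (β : ℤ) (ι : K →+* ℂ)
    (d₁ : KolyvaginHeegnerData Dt β ι 1) (hy : ¬ IsOfFinAddOrder d₁.derivedPoint) :
    (W.baseChange K).mordellWeilRank = 1 ∧ (W.baseChange K).ShaFinite := by
  obtain ⟨Ph, hPh, -, hnt⟩ :=
    exists_isHeegnerPoint_map_eq_derivedPoint_one_of_not_isOfFinAddOrder W hK hHe Dt β ι d₁ hy
  exact hKoly hK hHe hPh hnt

omit [W.IsGloballyMinimal] in
/-- **`L'(E/K, 1) ≠ 0` on the stub's frame, modulo Gross–Zagier** («in particular `y_K` has infinite order iff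
`L'(E/K,1) ≠ 0`», Gross 1991 (1.1); tree `lDerivEK_ne_zero_iff_not_isOfFinAddOrder`), at the `K`-rational Heegner point
of §1. [cite: GrossZagier1986, Thm. I.(6.3) and V.§2] [cite: GrossLMS1991, §1 (1.1)] -/
theorem lDerivEK_ne_zero_of_derivedPoint_one_of_grossZagier
    (hGZ : gross_zagier (W.conductorNorm ℤ) W K) (hK : IsImaginaryQuadratic K)
    (hHe : SatisfiesHeegnerHypothesis (W.conductorNorm ℤ) K)
    (Dt : ModularParametrizationData W (W.conductorNorm ℤ)) (β : ℤ) (ι : K →+* ℂ)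
    (d₁ : KolyvaginHeegnerData Dt β ι 1) (hy : ¬ IsOfFinAddOrder d₁.derivedPoint) :
    LDerivEK W K ≠ 0 := by
  obtain ⟨Ph, hPh, -, hnt⟩ :=
    exists_isHeegnerPoint_map_eq_derivedPoint_one_of_not_isOfFinAddOrder W hK hHe Dt β ι d₁ hy
  exact (lDerivEK_ne_zero_iff_not_isOfFinAddOrder W (W.conductorNorm ℤ) K hGZ hK hHe hPh).mpr hnt

/-- **`rank E(K) = 1` and `Ш(E/K)` finite on the stub's frame, modulo Gross–Zagier and bsd.S16** (the named facts
`gross_zagier N_E W K` and `mordellWeilRank_eq_one_of_LDerivEK_ne_zero W K` = «`L'(E/K,1) ≠ 0 ⟹ rank E(K) = 1`,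
Gross 1991 (1.1) + Thm. 1.3»). [cite: GrossLMS1991, §1 (1.1) and Thm. 1.3] [cite: Kolyvagin1990, Thm. A] -/
theorem mordellWeilRank_eq_one_of_derivedPoint_one_of_grossZagier
    (hGZ : gross_zagier (W.conductorNorm ℤ) W K) (hS16 : mordellWeilRank_eq_one_of_LDerivEK_ne_zero W K)
    (hK : IsImaginaryQuadratic K) (hHe : SatisfiesHeegnerHypothesis (W.conductorNorm ℤ) K)
    (Dt : ModularParametrizationData W (W.conductorNorm ℤ)) (β : ℤ) (ι : K →+* ℂ)
    (d₁ : KolyvaginHeegnerData Dt β ι 1) (hy : ¬ IsOfFinAddOrder d₁.derivedPoint) :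
    (W.baseChange K).mordellWeilRank = 1 ∧ (W.baseChange K).ShaFinite :=
  hS16 hK hHe (lDerivEK_ne_zero_of_derivedPoint_one_of_grossZagier W hGZ hK hHe Dt β ι d₁ hy)

/-! ## §3 The `ε`-line on the stub's frame -/

/-- **The `ε`-line on the frame of `stub_positiveDepth`, modulo Kolyvagin's theorem only.**  `K` imaginary
quadratic, Heegner for `N_E`, `τ ≠ 1`, a conductor-`1` datum with `P(1)` of infinite order, `kolyvagin N_E W K`:
for every `x ∈ E(K)`, `τ x − (−w(E)) x` is torsion (hand 6's `isOfFinAddOrder_map_sub_smul_of_mordellWeilRank_eq_one` ∘ §1–§2).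
[cite: GrossLMS1991, §5 Prop. 5.3 and §1 Thm. 1.3] [cite: SilvermanAEC2009, VIII.6] -/
theorem isOfFinAddOrder_map_sub_smul_of_derivedPoint_one_of_kolyvagin
    (hKoly : kolyvagin (W.conductorNorm ℤ) W K) (hK : IsImaginaryQuadratic K)
    (hHe : SatisfiesHeegnerHypothesis (W.conductorNorm ℤ) K) (τ : K ≃ₐ[ℚ] K) (hτ : τ ≠ 1)
    (Dt : ModularParametrizationData W (W.conductorNorm ℤ)) (β : ℤ) (ι : K →+* ℂ)
    (d₁ : KolyvaginHeegnerData Dt β ι 1) (hy : ¬ IsOfFinAddOrder d₁.derivedPoint)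
    (x : (W.baseChange K).toAffine.Point) :
    IsOfFinAddOrder (Affine.Point.map (W' := W) (τ : K →ₐ[ℚ] K) x - (-W.rootNumber) • x) := by
  obtain ⟨Ph, hPh, -, hnt⟩ :=
    exists_isHeegnerPoint_map_eq_derivedPoint_one_of_not_isOfFinAddOrder W hK hHe Dt β ι d₁ hy
  exact isOfFinAddOrder_map_sub_smul_of_mordellWeilRank_eq_one W hK hHe τ hτ (hKoly hK hHe hPh hnt).1 hPh hnt x

/-! ## §4 The trivial-`Ш` regime in stub currency, frame inputs discharged -/

/-- **ON A TRIVIAL-`Ш` FRAME THE FIRST DESCENT DROPS AT MOST ONE BIT — in the stub's own currency, modulo two named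
facts.**  Binders of `stub_positiveDepth` (`ρ̄_{E,2}` onto, odd Tamagawa product; `K` imaginary quadratic with odd
`d_K ≠ −3`, Heegner for `N_E`; `Dt, β, ι`, a conductor-`1` datum `d₁` with `P(1)` of infinite order and `2 ∣ P(1)`),
Gross's Prop. 3.7 (2) as the named fact `prop37_2_reductionCongruence_inert N_E W K`, Kolyvagin's theorem as the named
fact `kolyvagin N_E W K`, and `Ш(E/K)[2^∞] = ⊥`.  Then there is an EXACT depth `M₀ ≥ 1` (`2^{M₀} ∥ P(1)` in `E(K[1])`)
such that for every `L ≥ M₀`, every Zhang–Kolyvagin prime `ℓ` at `2` of index `≥ L` and every datum `e` of conductor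
`ℓ`: `2^{M₀−1} ∣ P_e(ℓ)` in `E(K[ℓ])` (hand 6's `exists_exactDepth_and_forall_pow_dvd_of_sha_eq_bot`, `τ`/`hline` from §1/§3).
[cite: McCallumLMS1991, §5 (Prop. 5.2, Thm. 5.4)] [cite: GrossLMS1991, §5 (5.1), Prop. 5.3, §1 Thm. 1.3] -/
theorem exists_exactDepth_and_forall_pow_dvd_of_sha_eq_bot_of_kolyvagin (hρ2 : W.HasSurjectiveModNGaloisRep 2)
    (hT : Odd W.tamagawaProduct)
    (hK : IsImaginaryQuadratic K) (hodd : Odd (NumberField.discr K)) (h3 : NumberField.discr K ≠ -3)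
    (hHe : SatisfiesHeegnerHypothesis (W.conductorNorm ℤ) K)
    (h37 : prop37_2_reductionCongruence_inert (W.conductorNorm ℤ) W K)
    (hKoly : kolyvagin (W.conductorNorm ℤ) W K)
    (hSha : AddCommGroup.primaryComponent (W.baseChange K).sha 2 = ⊥)
    (Dt : ModularParametrizationData W (W.conductorNorm ℤ)) (β : ℤ) (ι : K →+* ℂ)
    (d₁ : KolyvaginHeegnerData Dt β ι 1) (hy : ¬ IsOfFinAddOrder d₁.derivedPoint)
    (hpos : ∃ Q : (W.baseChange (ringClassField K ι 1)).toAffine.Point, (2 : ℤ) • Q = d₁.derivedPoint) :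
    ∃ M₀ : ℕ, 1 ≤ M₀ ∧
      (∃ Q : (W.baseChange (ringClassField K ι 1)).toAffine.Point, ((2 ^ M₀ : ℕ) : ℤ) • Q = d₁.derivedPoint) ∧
      (¬ ∃ Q : (W.baseChange (ringClassField K ι 1)).toAffine.Point,
        ((2 ^ (M₀ + 1) : ℕ) : ℤ) • Q = d₁.derivedPoint) ∧
      ∀ (L : ℕ), M₀ ≤ L → ∀ (ℓ : ℕ), Zhang2014.IsKolyvaginPrime (W.conductorNorm ℤ) W K 2 ℓ →
        L ≤ Zhang2014.kolyvaginIndex W 2 ℓ → ∀ e : KolyvaginHeegnerData Dt β ι ℓ,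
          ∃ Q : (W.baseChange (ringClassField K ι ℓ)).toAffine.Point,
            ((2 ^ (M₀ - 1) : ℕ) : ℤ) • Q = e.derivedPoint := by
  obtain ⟨τ, hτ⟩ := exists_algEquiv_ne_one_of_isImaginaryQuadratic hK
  exact exists_exactDepth_and_forall_pow_dvd_of_sha_eq_bot W hρ2 hT hK hodd h3 hHe h37 τ hτ
    (isOfFinAddOrder_map_sub_smul_of_derivedPoint_one_of_kolyvagin W hKoly hK hHe τ hτ Dt β ι d₁ hy) hSha
    Dt β ι d₁ hy hpos

/-- **NO DEEP PRIME-LEVEL WITNESS OF THE CRUX IN THE TRIVIAL-`Ш` REGIME OF DEPTH `≥ 2` — stub currency, modulo two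
named facts.**  Same frame as `exists_exactDepth_and_forall_pow_dvd_of_sha_eq_bot_of_kolyvagin`, with `4 ∣ P(1)` in
`E(K[1])`: the exact depth is some `M₀ ≥ 2`, and for every Zhang–Kolyvagin prime `ℓ` at `2` of index `≥ M₀` and every
datum `e` of conductor `ℓ`, **`P_e(ℓ) ∈ 2E(K[ℓ])`** — a witness `(n, d)` of `CMKolyvaginConjectureAtInertTwo` on such a
frame is composite or has a prime of index `< M₀`.
[cite: McCallumLMS1991, §5 (Prop. 5.2, Thm. 5.4)] [cite: GrossLMS1991, §5 (5.1), Prop. 5.3, §1 Thm. 1.3] -/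
theorem exists_exactDepth_two_le_and_forall_two_dvd_of_sha_eq_bot_of_kolyvagin
    (hρ2 : W.HasSurjectiveModNGaloisRep 2) (hT : Odd W.tamagawaProduct)
    (hK : IsImaginaryQuadratic K) (hodd : Odd (NumberField.discr K)) (h3 : NumberField.discr K ≠ -3)
    (hHe : SatisfiesHeegnerHypothesis (W.conductorNorm ℤ) K)
    (h37 : prop37_2_reductionCongruence_inert (W.conductorNorm ℤ) W K)
    (hKoly : kolyvagin (W.conductorNorm ℤ) W K)
    (hSha : AddCommGroup.primaryComponent (W.baseChange K).sha 2 = ⊥)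
    (Dt : ModularParametrizationData W (W.conductorNorm ℤ)) (β : ℤ) (ι : K →+* ℂ)
    (d₁ : KolyvaginHeegnerData Dt β ι 1) (hy : ¬ IsOfFinAddOrder d₁.derivedPoint)
    (hpos4 : ∃ Q : (W.baseChange (ringClassField K ι 1)).toAffine.Point, (4 : ℤ) • Q = d₁.derivedPoint) :
    ∃ M₀ : ℕ, 2 ≤ M₀ ∧
      (∃ Q : (W.baseChange (ringClassField K ι 1)).toAffine.Point, ((2 ^ M₀ : ℕ) : ℤ) • Q = d₁.derivedPoint) ∧
      (¬ ∃ Q : (W.baseChange (ringClassField K ι 1)).toAffine.Point,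
        ((2 ^ (M₀ + 1) : ℕ) : ℤ) • Q = d₁.derivedPoint) ∧
      ∀ (ℓ : ℕ), Zhang2014.IsKolyvaginPrime (W.conductorNorm ℤ) W K 2 ℓ →
        M₀ ≤ Zhang2014.kolyvaginIndex W 2 ℓ → ∀ e : KolyvaginHeegnerData Dt β ι ℓ,
          ∃ Q : (W.baseChange (ringClassField K ι ℓ)).toAffine.Point, (2 : ℤ) • Q = e.derivedPoint := by
  -- `4 ∣ P(1)` gives `2 ∣ P(1)`
  have hpos : ∃ Q : (W.baseChange (ringClassField K ι 1)).toAffine.Point, (2 : ℤ) • Q = d₁.derivedPoint := by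
    obtain ⟨Q, hQ⟩ := hpos4
    exact ⟨(2 : ℤ) • Q, by rw [smul_smul]; norm_num; exact hQ⟩
  obtain ⟨M₀, hM₀, hdiv, hndiv, hall⟩ := exists_exactDepth_and_forall_pow_dvd_of_sha_eq_bot_of_kolyvagin W hρ2 hT
    hK hodd h3 hHe h37 hKoly hSha Dt β ι d₁ hy hpos
  -- `M₀ ≥ 2`: otherwise `2^{M₀+1} = 4 ∣ P(1)`
  have hM₀2 : 2 ≤ M₀ := by
    by_contra hlt
    have hM₀1 : M₀ = 1 := by omega
    subst hM₀1
    exact hndiv (by simpa using hpos4)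
  refine ⟨M₀, hM₀2, hdiv, hndiv, fun ℓ hKol hidx e ↦ ?_⟩
  obtain ⟨Q, hQ⟩ := hall M₀ le_rfl ℓ hKol hidx e
  refine ⟨((2 ^ (M₀ - 2) : ℕ) : ℤ) • Q, ?_⟩
  rw [smul_smul, ← hQ, show (2 : ℤ) * ((2 ^ (M₀ - 2) : ℕ) : ℤ) = ((2 ^ (M₀ - 1) : ℕ) : ℤ) by
    rw [show M₀ - 1 = (M₀ - 2) + 1 by omega, pow_succ]; push_cast; ring]

/-! ## §5 Hand 7's `E(K)`-currency frame inputs from the stub's binders -/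

-- adapted from Theorems/CMKolyvaginAtInertTwoCMExactDescentAtTwo (`CMExactDescent.eq_zero_of_two_pow_smul_eq_zero_ringClassField`),
-- re-proved here to keep this file out of the route's Theses cone
omit [NeZero (W.conductorNorm ℤ)] in
/-- **`E(K[1])[2^∞] = 0` on the habitat** (`ρ̄_{E,2}` onto: no rational `2`-torsion,
`DokchitserDokchitser2012.forall_two_nsmul_of_hasSurjectiveModNGaloisRep_two`; `K` imaginary quadratic with odd `d_K`
(`d_K ≡ 1 (mod 4)`) and Heegner for `N_E`: no `2`-torsion over `K[1]`, `Uniform.U2.RingClass.forall_two_nsmul_eq_zero_of_heegner`;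
induction on the exponent).  Gross's Lemma 4.3 shape at `p = 2`.
[cite: GrossLMS1991, §4 Lemma 4.3 (shape; here at p = 2)] -/
theorem eq_zero_of_two_pow_zsmul_eq_zero_ringClassField_one (hρ2 : W.HasSurjectiveModNGaloisRep 2)
    (hK : IsImaginaryQuadratic K) (hodd : Odd (NumberField.discr K))
    (hHe : SatisfiesHeegnerHypothesis (W.conductorNorm ℤ) K) (ι : K →+* ℂ) (M : ℕ)
    (R : (W.baseChange (ringClassField K ι 1)).toAffine.Point) (hR : ((2 ^ M : ℕ) : ℤ) • R = 0) : R = 0 := by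
  haveI := (finiteDimensional_and_isGalois_ringClassField hK ι one_ne_zero).1
  haveI : NumberField (ringClassField K ι 1) := NumberField.of_module_finite K _
  have hD4 : NumberField.discr K % 4 = 1 :=
    Literature.NumberTheory.QuadraticFields.Quadratic.discr_emod_four_eq_one hK.1 hodd
  have hT : ∀ P : W.toAffine.Point, 2 • P = 0 → P = 0 := by
    intro P hP
    have h := DokchitserDokchitser2012.forall_two_nsmul_of_hasSurjectiveModNGaloisRep_two W
      two_ne_zero hρ2 P (by convert hP)
    convert h
  have h1 : ∀ Q : (W.baseChange (ringClassField K ι 1 : Type)).toAffine.Point, (2 : ℕ) • Q = 0 → Q = 0 :=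
    fun Q hQ ↦ Uniform.U2.RingClass.forall_two_nsmul_eq_zero_of_heegner W hK ι hD4 hHe hT one_ne_zero Q hQ
  induction M generalizing R with
  | zero => simpa using hR
  | succ M ih =>
    have h2 : (2 : ℕ) • (((2 ^ M : ℕ) : ℤ) • R) = 0 := by
      rw [← natCast_zsmul, smul_smul, ← Nat.cast_mul, ← pow_succ', hR]
    exact ih R (h1 _ h2)

/-- **`2^M ∣ P(1)` in `E(K[1])` iff `2^M ∣ Ph` in `E(K)`** for `Ph ∈ E(K)` over `P(1)`, on the habitat (`ρ̄_{E,2}` onto,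
`K` imaginary quadratic with odd `d_K`, Heegner for `N_E`, so that `E(K[1])[2^∞] = 0`): McCallum's Lemma 5.1 (first display), the tree's
`Koly.pDiv_one_iff_exists_zsmul_eq`. [cite: McCallumLMS1991, §5 Lemma 5.1] [cite: GrossLMS1991, §4 Lemma 4.3] -/
theorem pDiv_one_two_iff_exists_zsmul_eq (hρ2 : W.HasSurjectiveModNGaloisRep 2) (hK : IsImaginaryQuadratic K)
    (hodd : Odd (NumberField.discr K)) (hHe : SatisfiesHeegnerHypothesis (W.conductorNorm ℤ) K)
    {Dt : ModularParametrizationData W (W.conductorNorm ℤ)} {β : ℤ} {ι : K →+* ℂ}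
    (d₁ : KolyvaginHeegnerData Dt β ι 1) {Ph : (W.baseChange K).toAffine.Point}
    (hmap : Affine.Point.map (W' := W) (algebraMap K (ringClassField K ι 1)).toRatAlgHom Ph = d₁.derivedPoint)
    (M : ℕ) :
    (∃ Q : (W.baseChange (ringClassField K ι 1)).toAffine.Point, ((2 ^ M : ℕ) : ℤ) • Q = d₁.derivedPoint) ↔
      ∃ Q : (W.baseChange K).toAffine.Point, ((2 ^ M : ℕ) : ℤ) • Q = Ph :=
  Koly.pDiv_one_iff_exists_zsmul_eq hK d₁ Ph hmap 2 M
    fun R hR ↦ eq_zero_of_two_pow_zsmul_eq_zero_ringClassField_one W hρ2 hK hodd hHe ι M R hR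

/-- **Hand 7's `E(K)`-currency frame from the stub's binders (no named fact).**  On the habitat (`ρ̄_{E,2}` onto; `K`
imaginary quadratic, odd `d_K`, Heegner for `N_E`), for a conductor-`1` datum `d₁` with `P(1)` of infinite order and
EXACT depth `M₀` in `E(K[1])` (`2^{M₀} ∣ P(1)`, `2^{M₀+1} ∤ P(1)`), and any conjugation `c ≠ 1`: there is a `K`-rational
Heegner point `Ph` of level `N_E` over `P(1)`, of infinite order, with `2^{M₀} ∣ Ph` and `2^{M₀+1} ∤ Ph` IN `E(K)`, and
with `c Ph − w(E) Ph` NOT torsion (Gross Prop. 5.3: `c Ph + w(E) Ph` is torsion; the two differ by `2w(E) Ph`) —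
i.e. exactly the inputs `(hHP, hM₀, hM₀', hν, hPν)` of `KolyvaginDescentTwo.exists_not_dvd_derivedPoint_of_selmer_minus_two_pow`
with `ν = w(E)`. [cite: GrossLMS1991, §4 (P_1 = y_K), §5 Prop. 5.3] [cite: McCallumLMS1991, §5 Lemma 5.1] -/
theorem exists_heegnerPoint_exactDepth_of_derivedPoint_one (hρ2 : W.HasSurjectiveModNGaloisRep 2)
    (hK : IsImaginaryQuadratic K) (hodd : Odd (NumberField.discr K))
    (hHe : SatisfiesHeegnerHypothesis (W.conductorNorm ℤ) K) {c : K ≃ₐ[ℚ] K} (hc : c ≠ 1)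
    (Dt : ModularParametrizationData W (W.conductorNorm ℤ)) (β : ℤ) (ι : K →+* ℂ)
    (d₁ : KolyvaginHeegnerData Dt β ι 1) (hy : ¬ IsOfFinAddOrder d₁.derivedPoint) {M₀ : ℕ}
    (hdiv : ∃ Q : (W.baseChange (ringClassField K ι 1)).toAffine.Point, ((2 ^ M₀ : ℕ) : ℤ) • Q = d₁.derivedPoint)
    (hndiv : ¬ ∃ Q : (W.baseChange (ringClassField K ι 1)).toAffine.Point,
      ((2 ^ (M₀ + 1) : ℕ) : ℤ) • Q = d₁.derivedPoint) :
    ∃ Ph : (W.baseChange K).toAffine.Point, IsHeegnerPoint (W.conductorNorm ℤ) W K Ph ∧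
      Affine.Point.map (W' := W) (algebraMap K (ringClassField K ι 1)).toRatAlgHom Ph = d₁.derivedPoint ∧
      ¬ IsOfFinAddOrder Ph ∧
      (∃ Q : (W.baseChange K).toAffine.Point, (((2 : ℕ) : ℤ) ^ M₀) • Q = Ph) ∧
      (∀ Q : (W.baseChange K).toAffine.Point, (((2 : ℕ) : ℤ) ^ (M₀ + 1)) • Q ≠ Ph) ∧
      ¬ IsOfFinAddOrder (Affine.Point.map (W' := W) (c : K →ₐ[ℚ] K) Ph - W.rootNumber • Ph) := by
  obtain ⟨Ph, hPh, hmap, hnt⟩ :=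
    exists_isHeegnerPoint_map_eq_derivedPoint_one_of_not_isOfFinAddOrder W hK hHe Dt β ι d₁ hy
  refine ⟨Ph, hPh, hmap, hnt, ?_, ?_, ?_⟩
  · obtain ⟨Q, hQ⟩ := (pDiv_one_two_iff_exists_zsmul_eq W hρ2 hK hodd hHe d₁ hmap M₀).mp hdiv
    exact ⟨Q, by rw [← Nat.cast_pow]; exact hQ⟩
  · intro Q hQ
    refine hndiv ((pDiv_one_two_iff_exists_zsmul_eq W hρ2 hK hodd hHe d₁ hmap (M₀ + 1)).mpr ⟨Q, ?_⟩)
    rw [Nat.cast_pow]; exact hQ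
  · -- Gross Prop. 5.3: `c Ph − (−w) Ph` is torsion; were `c Ph − w Ph` torsion too, so would be `2w·Ph`, hence `Ph`
    have hgross := Rank1Residual.X11b.KolyvaginBottom.isOfFinAddOrder_map_sub_neg_rootNumber_smul
      (W := W) hK hHe hPh c hc
    intro h'
    apply hnt
    have hw : (2 * W.rootNumber : ℤ) ≠ 0 := by
      rcases W.rootNumber_eq_one_or with h | h <;> simp [h]
    have hdiff : IsOfFinAddOrder ((2 * W.rootNumber) • Ph) := by
      have heq : (2 * W.rootNumber) • Ph =
          (Affine.Point.map (W' := W) (c : K →ₐ[ℚ] K) Ph - (-W.rootNumber) • Ph) -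
            (Affine.Point.map (W' := W) (c : K →ₐ[ℚ] K) Ph - W.rootNumber • Ph) := by
        rw [sub_sub_sub_cancel_left, neg_smul, sub_neg_eq_add, ← add_smul, two_mul]
      rw [heq, sub_eq_add_neg]
      exact hgross.add h'.neg
    obtain ⟨n, hn0, hn⟩ := (isOfFinAddOrder_iff_zsmul_eq_zero).mp hdiff
    rw [smul_smul] at hn
    exact (isOfFinAddOrder_iff_zsmul_eq_zero).mpr ⟨n * (2 * W.rootNumber), mul_ne_zero hn0 hw, hn⟩

/-! ## §6 Hand 7's strict first step, on the stub's frame -/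

/-- **ONE STRICT DESCENT STEP FROM AN ELEMENT OF ORDER `≥ 4` IN `Sel_{2^M}(E/K)^{w(E)}`, ON THE FRAME OF
`stub_positiveDepth`.**  Binders of the stub (`W` globally minimal with CM, `2` CM-inert, `ρ̄_{E,2}` onto, odd Tamagawa
product; `K` imaginary quadratic, odd `d_K ≠ −3`, Heegner for `N_E`; `Dt, β, ι`, a conductor-`1` datum `d₁` with `P(1)`
of infinite order) with the EXACT depth `M₀` of `P(1)` in `E(K[1])`; the route's standing machine inputs at `2`
(Gross 3.7 (2) `h372` by name, Gross 5.3 binder `h53`, a conjugation `c ≠ 1`, the Cartan-type `z` with `hzfix`/`hcomm`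
at level `2^{M+M₀}`, ty2's reciprocity DATA `R`); and a class `s ∈ Sel_{2^M}(E/K)` with `c_* s = w(E)·s` and
`2·s ≠ 0`.  THEN there are a CM-inert Kolyvagin prime `ℓ` at `2` IN THE CRUX'S CURRENCY (W. Zhang's
`Zhang2014.IsKolyvaginPrime`, from Gross's (3.1)–(3.2) by `Zhang2014.isKolyvaginPrime_of_isKolyvaginPrime` for the curve
of the newform `Dt.f`) with `Frob_ℓ = Frob_∞` on `K(E[2^{M+M₀}])`, a frame and a datum `e` of conductor `ℓ` with
`2^{M₀} ∤ P_e(ℓ)` in `E(K[ℓ])` — a strict first step `m(ℓ) < M₀ = m(1)` (hand 7's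
`KolyvaginDescentTwo.exists_strictDescent_of_selmer_minus_two_zsmul_ne_zero`, frame inputs from §5 at `ν = w(E)`).
[cite: McCallumLMS1991, §5 Lemma 5.1, Prop. 5.2, Lemma 5.3, Thm. 5.4] [cite: GrossLMS1991, Prop. 2.1 with §10, §3 (3.1)–(3.3), §5 Prop. 5.3] -/
theorem exists_strictDescent_of_selmer_minus_two_zsmul_ne_zero_of_derivedPoint_one
    (hCMW : W.HasCM) (hin : Rank1Residual.CMInert W 2) (hρ2 : W.HasSurjectiveModNGaloisRep 2)
    (hT : Odd W.tamagawaProduct)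
    (hK : IsImaginaryQuadratic K) (hodd : Odd (NumberField.discr K)) (h3 : NumberField.discr K ≠ -3)
    (hHe : SatisfiesHeegnerHypothesis (W.conductorNorm ℤ) K)
    (h372 : prop37_2_reductionCongruence_inert (W.conductorNorm ℤ) W K)
    (h53 : ∀ [W.IsElliptic] (_hK : IsImaginaryQuadratic K) (_hH : SatisfiesHeegnerHypothesis (W.conductorNorm ℤ) K)
      (Dt : ModularParametrizationData W (W.conductorNorm ℤ)) (β : ℤ) (ι : K →+* ℂ) {M : ℕ}
      (_hM : 1 ≤ M) {n : ℕ} (_hn : Squarefree n)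
      (_hKol : ∀ q ∈ n.primeFactors, IsKolyvaginPrime (W.conductorNorm ℤ) W K 2 q ∧
        FrobEqFrobInfty W K (2 ^ M) q)
      (d : (m : ℕ) → m ∣ n → KolyvaginHeegnerData Dt β ι m) (m : ℕ) (hm : m ∣ n)
      (τm : ringClassField K ι m ≃ₐ[ℚ] ringClassField K ι m),
      (∀ x : ringClassField K ι m, ((τm x : ringClassField K ι m) : ℂ) = starRingEnd ℂ x) →
      ∃ σ' ∈ ringClassGal ι m, IsOfFinAddOrder
        (pointGalHom W (ringClassField K ι m) τm (d m hm).y -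
          (-W.rootNumber) • pointGalHom W (ringClassField K ι m) σ' (d m hm).y))
    {c : K ≃ₐ[ℚ] K} (hc : c ≠ 1)
    (Dt : ModularParametrizationData W (W.conductorNorm ℤ)) (β : ℤ) (ι : K →+* ℂ)
    (d₁ : KolyvaginHeegnerData Dt β ι 1) (hy : ¬ IsOfFinAddOrder d₁.derivedPoint) {M₀ : ℕ}
    (hdiv : ∃ Q : (W.baseChange (ringClassField K ι 1)).toAffine.Point, ((2 ^ M₀ : ℕ) : ℤ) • Q = d₁.derivedPoint)
    (hndiv : ¬ ∃ Q : (W.baseChange (ringClassField K ι 1)).toAffine.Point,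
      ((2 ^ (M₀ + 1) : ℕ) : ℤ) • Q = d₁.derivedPoint)
    {M : ℕ} (hM : 1 ≤ M) {z : absoluteGaloisGroup K}
    (hzfix : ∀ T : geomTorsion (W.baseChange K) ((2 : ℕ) : ℤ), z • T = T → T = 0)
    (hcomm : ∀ π ∈ torsionFixing (W.baseChange K) ((2 : ℕ) : ℤ),
      ∀ T : geomTorsion (W.baseChange K) ((2 ^ (M + M₀) : ℕ) : ℤ), π • z • T = z • π • T)
    (R : Rank1Residual.P2.KolyvaginMachine.ReciprocityFamily (W.conductorNorm ℤ) W K 2 fun _ ↦ True)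
    {s : galH1Torsion (W.baseChange K) ((2 ^ M : ℕ) : ℤ)}
    (hs : s ∈ selmerGroup (W.baseChange K) ((2 ^ M : ℕ) : ℤ))
    (hsν : conjAct W c ((2 ^ M : ℕ) : ℤ) s = W.rootNumber • s)
    (h2 : ((2 : ℕ) : ℤ) • s ≠ 0) :
    ∃ ℓ : ℕ, Zhang2014.IsKolyvaginPrime (W.conductorNorm ℤ) W K 2 ℓ ∧ FrobEqFrobInfty W K (2 ^ (M + M₀)) ℓ ∧
      Rank1Residual.CMInert W ℓ ∧
      ∃ (Dt' : ModularParametrizationData W (W.conductorNorm ℤ)) (β' : ℤ) (ι' : K →+* ℂ)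
        (e : KolyvaginHeegnerData Dt' β' ι' ℓ),
        ∀ Q₀ : (W.baseChange (ringClassField K ι' ℓ)).toAffine.Point,
          (((2 : ℕ) : ℤ) ^ M₀) • Q₀ ≠ e.derivedPoint := by
  obtain ⟨Ph, hPh, -, -, hM₀E, hM₀E', hPν⟩ :=
    exists_heegnerPoint_exactDepth_of_derivedPoint_one W hρ2 hK hodd hHe hc Dt β ι d₁ hy hdiv hndiv
  have hΔ : W.Δ < 0 := KolyvaginEigenTwo.Δ_neg_of_cmInert_two W hCMW hin hρ2
  have hΔK : ¬ IsSquare (W.baseChange K).Δ := by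
    have h : (W.baseChange K).Δ = algebraMap ℚ K W.Δ := by rw [baseChange, map_Δ]
    rw [h]
    exact KolyvaginImageTwo.not_isSquare_algebraMap_Δ_of_cmInert_two_of_heegner W hCMW hin hρ2 K hK hHe
  have hν : W.rootNumber = 1 ∨ W.rootNumber = -1 := W.rootNumber_eq_one_or
  obtain ⟨ℓ, hℓ, hF, hcm, Dt', β', ι', e, he⟩ :=
    KolyvaginDescentTwo.exists_strictDescent_of_selmer_minus_two_zsmul_ne_zero rfl hCMW hin hρ2 hT hK hodd
      h3 hHe hPh h372 h53 hΔ hΔK hc hM hzfix hcomm hM₀E hM₀E' hν hPν R hs hsν h2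
  -- Gross's Kolyvagin prime (3.1)–(3.2) is W. Zhang's (the crux's currency), for the curve of the newform `Dt.f`
  exact ⟨ℓ, Zhang2014.isKolyvaginPrime_of_isKolyvaginPrime W Dt.isNewformOf Nat.prime_two hℓ, hF, hcm,
    Dt', β', ι', e, he⟩

end Summit.BirchSwinnertonDyer.BirchSwinnertonDyer.Theorems.CMKolyvaginFirstDescentTwo

end
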